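import Literature.NumberTheory.EllipticCurves.TorsionCardinality
import Summits.BirchSwinnertonDyer.Rank1Residual.GaloisImage.LocalThreeTorsionDecider
import HarnessLib

/-!
# The `n`-division equation of a rational point: field-generic algebra (any `n`) and the
# computable integer coefficient list for `n = 3` (team n1011, row T-DIV3L, FILE D1)

HONEST FRAMING (cell `b2b-bsdres`, run/shared/lean/b2b/bsd-rank1-residual/, verbatim in every
file): the goal of the cell is to DELETE the COMBINATION-SHAPED residual classes of the
Birch–Swinnerton-Dyer formula for ALL analytic-rank `≤ 1` elliptic curves over `ℚ` — "full BSD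
formula for every rank `≤ 1` curve in class `C`" assembled STRICTLY from published theorems — so
that the rank-`≤ 1` remainder becomes exactly the CONSTRUCTION-SHAPED classes, which are TYPED
(missing-input `Prop`s), NOT attempted. This is not "finishing BSD". Team n1011 (N10/N11): research
route; this file is a TOOL (division-polynomial algebra + integer bookkeeping); nothing is booked by
it; no mark / label moved; X4 stays CONSTRUCTION-SHAPED. THEOREMS + three small COMPUTABLE
coefficient-list definitions (no mathematical content); no named fact, no `sorry`.

## What

The exact kernel decider for local `p`-divisibility of a rational point (row T-DIV3L; the `ℚ_ℓ`
decider is FILE D2 `LocalThreeDivisibilityDeciderAt`) rests on the **`n`-division equation** of a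
point `P = (x_P, y_P)` with `x_P = num/den`:
`F_P(X) := den·Φₙ(X) − num·ΨSqₙ(X)`, where `Φₙ`, `ΨSqₙ = ψₙ²` are Mathlib's univariate division
polynomials (`WeierstrassCurve.Φ`, `WeierstrassCurve.ΨSq`; `x(nQ) = Φₙ(x_Q)/ΨSqₙ(x_Q)`,
Silverman *AEC* Ex. 3.7(d), tree `Affine.Point.zsmul_some_eq_some_φ_div` /
`WeierstrassCurve.mul_eval_ΨSq_of_zsmul_eq`).

* §1 (any field, any `n : ℤ`): **NO lemma** `eval_divEq_eq_zero_of_zsmul_eq` — if `n • Q = P` with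
  `Q = (z, y_z)` then `F_P(z) = 0`; **YES lemma** `exists_zsmul_eq_of_eval_divEq_eq_zero` — if
  `(z, y_z)` is a nonsingular point with `F_P(z) = 0` (`den ≠ 0`) then `n • Q = P` for `Q = (z, y_z)`
  or `Q = -(z, y_z)` (`ΨSqₙ(z) ≠ 0` is automatic: `Φₙ`, `ΨSqₙ` have no common root at a point,
  tree `eval_Φ_ne_zero_of_eval_ΨSq_eq_zero`; then `x(n(z,y_z)) = x_P` and Mathlib
  `Affine.Y_eq_of_X_eq` fixes the sign).
* §2 (`n = 3`, integers): computable ascending coefficient lists `phi3List a₁ … a₆` (the ten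
  coefficients of `Φ₃ = X·Ψ₃² − preΨ₄·Ψ₂Sq`, Mathlib `WeierstrassCurve.Φ_three`, in the
  `b`-invariants), `psi3SqList` (`Ψ₃²`), `threeDivList a₁ … a₆ num den` (`den·Φ₃ − num·Ψ₃²`), with
  the identities `aeval_phi3List`, `aeval_psi3SqList`, `aeval_threeDivList` against Mathlib's
  `Φ 3`, `Ψ₃`, `ΨSq 3` on the integer model `⟨a₁, …, a₆⟩` read in any commutative ring (by `ring`),
  and `getLast_threeDivList` (leading coefficient `den`).

References: [SilvermanAEC2009] Exercise 3.7 (a)(c)(d)(f).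
-/

set_option autoImplicit false

noncomputable section

open scoped Classical
open Polynomial WeierstrassCurve
open Summit.BirchSwinnertonDyer.Rank1Residual.GaloisImage.RootCensus
  (ofList evalList aeval_ofList_cons aeval_ofList_nil)
open Summit.BirchSwinnertonDyer.Rank1Residual.GaloisImage.LocalTorsion3 (bInvs psi3List gList)

namespace Summit.BirchSwinnertonDyer.Rank1Residual.GaloisImage.ThreeDivision

/-! ### §1 The `n`-division equation of a point over a field -/

section Field

variable {F : Type*} [Field F] (V : WeierstrassCurve F)

/-- **NO lemma.** If `n • (z, y_z) = (x', y')` then `x' · ΨSqₙ(z) = Φₙ(z)`; with `x' = num / den`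
this is the `n`-division equation `den · Φₙ(z) - num · ΨSqₙ(z) = 0`.
[cite: SilvermanAEC2009, Exercise 3.7(d)] -/
theorem eval_divEq_eq_zero_of_zsmul_eq {z yz x' y' : F} (hz : V.toAffine.Nonsingular z yz)
    (h' : V.toAffine.Nonsingular x' y') (n : ℤ) {num den : F} (hden : den ≠ 0)
    (hx : x' = num / den)
    (hn : n • (Affine.Point.some z yz hz : V.toAffine.Point) = Affine.Point.some x' y' h') :
    den * (V.Φ n).eval z - num * (V.ΨSq n).eval z = 0 := by
  have key := V.mul_eval_ΨSq_of_zsmul_eq hz n h' hn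
  rw [← key, hx]
  field_simp
  ring

/-- **YES lemma.** If `(z, y_z)` is a nonsingular point whose `x`-coordinate satisfies the
`n`-division equation of the nonsingular point `P = (num/den, y_P)`, i.e.
`den · Φₙ(z) = num · ΨSqₙ(z)` with `den ≠ 0`, then `P = n • Q` for `Q = (z, y_z)` or `Q = -(z, y_z)`.
(`ΨSqₙ(z) ≠ 0` since `Φₙ` and `ΨSqₙ` do not both vanish at a point; then `x(n • (z, y_z)) = x(P)`
and two points with the same `x`-coordinate are equal or opposite.)
[cite: SilvermanAEC2009, Exercise 3.7(d)] -/
theorem exists_zsmul_eq_of_eval_divEq_eq_zero {z yz xP yP : F} (hz : V.toAffine.Nonsingular z yz)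
    (hP : V.toAffine.Nonsingular xP yP) (n : ℤ) {num den : F} (hden : den ≠ 0)
    (hx : xP = num / den) (hF : den * (V.Φ n).eval z - num * (V.ΨSq n).eval z = 0) :
    ∃ Q : V.toAffine.Point, n • Q = Affine.Point.some xP yP hP := by
  -- `ΨSqₙ(z) ≠ 0`
  have hΨ : (V.ΨSq n).eval z ≠ 0 := by
    intro h0
    have hΦ := V.eval_Φ_ne_zero_of_eval_ΨSq_eq_zero hz (n := n) h0
    rw [h0, mul_zero, sub_zero] at hF
    exact hΦ ((mul_eq_zero.mp hF).resolve_left hden)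
  have hψ : (V.ψ n).evalEval z yz ≠ 0 := by
    intro h0
    apply hΨ
    rw [← V.evalEval_ψ_sq hz.left n, h0, zero_pow two_ne_zero]
  -- `n • (z, y_z) = (Φₙ(z)/ΨSqₙ(z), y₁) = (xP, y₁)`
  obtain ⟨y₁, hns, e⟩ := Affine.Point.zsmul_some_eq_some_φ_div hz hψ
  have hx1 : (V.φ n).evalEval z yz / (V.ψ n).evalEval z yz ^ 2 = xP := by
    rw [V.evalEval_φ_eq_eval_Φ hz.left n, V.evalEval_ψ_sq hz.left n, hx]
    field_simp
    linear_combination hF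
  -- same `x`-coordinate: equal or opposite
  rcases Affine.Y_eq_of_X_eq hns.left hP.left hx1 with hy | hy
  · refine ⟨Affine.Point.some z yz hz, ?_⟩
    rw [e]
    exact Affine.Point.some.injEq _ _ _ _ _ _ |>.mpr ⟨hx1, hy⟩
  · refine ⟨-Affine.Point.some z yz hz, ?_⟩
    rw [zsmul_neg, e, Affine.Point.neg_some, Affine.Point.some.injEq]
    refine ⟨hx1, ?_⟩
    rw [hy, hx1, Affine.negY_negY]

/-- The `ℕ`-scalar form of the YES lemma. [cite: SilvermanAEC2009, Exercise 3.7(d)] -/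
theorem exists_nsmul_eq_of_eval_divEq_eq_zero {z yz xP yP : F} (hz : V.toAffine.Nonsingular z yz)
    (hP : V.toAffine.Nonsingular xP yP) (n : ℕ) {num den : F} (hden : den ≠ 0)
    (hx : xP = num / den) (hF : den * (V.Φ n).eval z - num * (V.ΨSq n).eval z = 0) :
    ∃ Q : V.toAffine.Point, n • Q = Affine.Point.some xP yP hP := by
  obtain ⟨Q, hQ⟩ := exists_zsmul_eq_of_eval_divEq_eq_zero V hz hP (n : ℤ) hden hx hF
  exact ⟨Q, by rw [← natCast_zsmul]; exact hQ⟩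

/-- The `ℕ`-scalar form of the NO lemma. [cite: SilvermanAEC2009, Exercise 3.7(d)] -/
theorem eval_divEq_eq_zero_of_nsmul_eq {z yz x' y' : F} (hz : V.toAffine.Nonsingular z yz)
    (h' : V.toAffine.Nonsingular x' y') (n : ℕ) {num den : F} (hden : den ≠ 0)
    (hx : x' = num / den)
    (hn : n • (Affine.Point.some z yz hz : V.toAffine.Point) = Affine.Point.some x' y' h') :
    den * (V.Φ n).eval z - num * (V.ΨSq n).eval z = 0 :=
  eval_divEq_eq_zero_of_zsmul_eq V hz h' (n : ℤ) hden hx (by rw [← natCast_zsmul] at hn; exact hn)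

end Field

/-! ### §2 The integer coefficient lists for `n = 3` -/

/-- Ascending coefficient list of `Φ₃ = X·Ψ₃² − preΨ₄·Ψ₂Sq` (monic of degree `9`), in the
`b`-invariants of the integer model `⟨a₁, …, a₆⟩`. [folklore] -/
def phi3List (a₁ a₂ a₃ a₄ a₆ : ℤ) : List ℤ :=
  let b := bInvs a₁ a₂ a₃ a₄ a₆
  let b₂ := b.1
  let b₄ := b.2.1
  let b₆ := b.2.2.1
  let b₈ := b.2.2.2
  [b₆ ^ 3 - b₄ * b₆ * b₈,
    3 * b₄ * b₆ ^ 2 - 2 * b₄ ^ 2 * b₈ - b₂ * b₆ * b₈ + b₈ ^ 2,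
    2 * b₄ ^ 2 * b₆ + b₂ * b₆ ^ 2 - 3 * b₂ * b₄ * b₈ - 4 * b₆ * b₈,
    b₂ * b₄ * b₆ - b₂ ^ 2 * b₈ + 3 * b₆ ^ 2 - 18 * b₄ * b₈,
    -3 * b₄ * b₆ - 12 * b₂ * b₈,
    -b₄ ^ 2 - 5 * b₂ * b₆ - 34 * b₈,
    -b₂ * b₄ - 24 * b₆,
    -6 * b₄,
    0,
    1]

/-- Ascending coefficient list of `Ψ₃² = ΨSq₃` (degree `8`), padded with a final `0` to length
`10`. [folklore] -/
def psi3SqList (a₁ a₂ a₃ a₄ a₆ : ℤ) : List ℤ :=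
  let b := bInvs a₁ a₂ a₃ a₄ a₆
  let b₂ := b.1
  let b₄ := b.2.1
  let b₆ := b.2.2.1
  let b₈ := b.2.2.2
  [b₈ ^ 2,
    6 * b₆ * b₈,
    9 * b₆ ^ 2 + 6 * b₄ * b₈,
    18 * b₄ * b₆ + 2 * b₂ * b₈,
    9 * b₄ ^ 2 + 6 * b₂ * b₆ + 6 * b₈,
    6 * b₂ * b₄ + 18 * b₆,
    b₂ ^ 2 + 18 * b₄,
    6 * b₂,
    9,
    0]

/-- **The `3`-division equation** of a point with `x`-coordinate `num / den` on the integer model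
`⟨a₁, …, a₆⟩`: ascending coefficient list of `den·Φ₃ − num·Ψ₃²` (ten entries, the last one is
`den`). [folklore] -/
def threeDivList (a₁ a₂ a₃ a₄ a₆ num den : ℤ) : List ℤ :=
  List.zipWith (fun φ s => den * φ - num * s) (phi3List a₁ a₂ a₃ a₄ a₆) (psi3SqList a₁ a₂ a₃ a₄ a₆)

section Lists

variable {A : Type*} [CommRing A] (a₁ a₂ a₃ a₄ a₆ : ℤ)

/-- `phi3List` evaluates to Mathlib's `Φ₃` of the integer model. [folklore] -/
theorem aeval_phi3List (z : A) :
    aeval z (ofList (phi3List a₁ a₂ a₃ a₄ a₆)) =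
      ((⟨(a₁ : A), (a₂ : A), (a₃ : A), (a₄ : A), (a₆ : A)⟩ : WeierstrassCurve A).Φ 3).eval z := by
  rw [WeierstrassCurve.Φ_three]
  simp only [phi3List, bInvs, aeval_ofList_cons, aeval_ofList_nil, eval_sub, eval_mul, eval_pow,
    eval_X, eval_add, eval_C, WeierstrassCurve.Ψ₃, WeierstrassCurve.preΨ₄, WeierstrassCurve.Ψ₂Sq,
    WeierstrassCurve.b₂, WeierstrassCurve.b₄, WeierstrassCurve.b₆, WeierstrassCurve.b₈, eval_ofNat]
  push_cast
  ring

/-- `psi3SqList` evaluates to `Ψ₃²` of the integer model. [folklore] -/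
theorem aeval_psi3SqList (z : A) :
    aeval z (ofList (psi3SqList a₁ a₂ a₃ a₄ a₆)) =
      (((⟨(a₁ : A), (a₂ : A), (a₃ : A), (a₄ : A), (a₆ : A)⟩ : WeierstrassCurve A).Ψ₃).eval z) ^ 2 := by
  simp only [psi3SqList, bInvs, aeval_ofList_cons, aeval_ofList_nil, eval_mul, eval_pow, eval_X,
    eval_add, eval_C, WeierstrassCurve.Ψ₃, WeierstrassCurve.b₂, WeierstrassCurve.b₄,
    WeierstrassCurve.b₆, WeierstrassCurve.b₈, eval_ofNat]
  push_cast
  ring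

/-- `psi3SqList` evaluates to Mathlib's `ΨSq 3` of the integer model. [folklore] -/
theorem aeval_psi3SqList_eq_ΨSq (z : A) :
    aeval z (ofList (psi3SqList a₁ a₂ a₃ a₄ a₆)) =
      ((⟨(a₁ : A), (a₂ : A), (a₃ : A), (a₄ : A), (a₆ : A)⟩ : WeierstrassCurve A).ΨSq 3).eval z := by
  rw [WeierstrassCurve.ΨSq_three, eval_pow, aeval_psi3SqList]

/-- **`threeDivList` evaluates to the `3`-division equation `den·Φ₃(z) − num·ΨSq₃(z)`** of the
integer model. [folklore] -/
theorem aeval_threeDivList (num den : ℤ) (z : A) :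
    aeval z (ofList (threeDivList a₁ a₂ a₃ a₄ a₆ num den)) =
      (den : A) * ((⟨(a₁ : A), (a₂ : A), (a₃ : A), (a₄ : A), (a₆ : A)⟩ : WeierstrassCurve A).Φ 3).eval z -
        (num : A) * ((⟨(a₁ : A), (a₂ : A), (a₃ : A), (a₄ : A), (a₆ : A)⟩ :
          WeierstrassCurve A).ΨSq 3).eval z := by
  rw [← aeval_phi3List, ← aeval_psi3SqList_eq_ΨSq]
  simp only [threeDivList, phi3List, psi3SqList, List.zipWith_cons_cons, List.zipWith_nil_right,
    aeval_ofList_cons, aeval_ofList_nil]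
  push_cast
  ring

/-- `threeDivList` has ten entries. [folklore] -/
theorem length_threeDivList (num den : ℤ) : (threeDivList a₁ a₂ a₃ a₄ a₆ num den).length = 10 := by
  simp [threeDivList, phi3List, psi3SqList]

/-- The leading coefficient of the `3`-division equation is `den` (`Φ₃` is monic of degree `9`,
`Ψ₃²` has degree `8`). [folklore] -/
theorem getLast_threeDivList (num den : ℤ) :
    (threeDivList a₁ a₂ a₃ a₄ a₆ num den).getLast? = some den := by
  simp [threeDivList, phi3List, psi3SqList]

end Lists


end Summit.BirchSwinnertonDyer.Rank1Residual.GaloisImage.ThreeDivision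

end
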